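import Literature.Computability.Complexity.ResourceBoundedMeasure
import Literature.Computability.Complexity.CodeFP
import HarnessLib

/-!
# Resource-bounded (Lutz) measure III: E-uniform systems and the three basic properties of §2.5.3

Companion to `ResourceBoundedMeasure.lean` (definitions `stdString`, `charPrefix`, `IsMartingale`,
`SucceedsOn`, `successSet`, `IsPComputable`, `PMeasureZero`, `PMeasureOneInE`, diagonalization
`not_pMeasureZero_univ`, `not_pMeasureZero_of_forall_diagLanguage_mem`) and to its PROVED closure
API in `ResourceBoundedMeasureClosure.lean` (`pMeasureZero_empty`, finite unions
`PMeasureZero.union`, `PMeasureZero.exists_not_mem`). This file adds the one further notion and the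
three theorems of van Melkebeek's §2.5.3 "Properties" that are machine constructions in the tree's
TM2 model, vendored as NAMED FACTS (D-0014) with their cheap consequences proved:

* `IsEUniform ds` — **E-uniform systems** of martingales `(d_i)_i`: `(i, w) ↦ d_i(w)` computable in
  time polynomial in `i` and `N = |w|` jointly (index in unary) [VanMelkebeek2000, §2.5.3];
  `isEUniform_cases` PROVES that two `p`-computable martingales form one (a `CodeFP` branch on the
  unary index), so the notion is inhabited non-trivially;
* `pMeasureZero_iUnion` — **Lutz's E-uniform union lemma** [VanMelkebeek2000, Thm. 2.5.2] (fact);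
* `not_pMeasureZero_E` — **measure conservation** `μ_E(E) ≠ 0` (fact), with the discharge path
  `not_pMeasureZero_E_of_diagLanguage_mem` and the consequences `not_pMeasureZero_of_E_subset`,
  `PMeasureZero.exists_mem_E_not_mem`;
* `pMeasureZero_DTIME` — **`DTIME[2^{cn}]` is `p`-null for every fixed `c`** (fact), with
  `P_subset_DTIME_two_pow` (`P ⊆ DTIME[2ⁿ]`, proved via `nᵈ ≤ dᵈ·2ⁿ`) and hence
  `pMeasureZero_P` (`μ_p(P) = 0`).

## Design notes

* In `IsEUniform` the index is presented in UNARY, `⟨1^i, w⟩ = boolPair (unaryEncodeNat i) w`, so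
  that "time polynomial in the input length" reads "polynomial in `i` and `N` jointly" — van
  Melkebeek's `iᶜ · 2^{cn}` with `2^{cn} = N^c` (the two agree up to the additive constants of the
  tree's time bounds and the degenerate values `i = 0`, `N = 0`). The value code is the one of
  `IsPComputable` (reduced fraction `(num, den)`).
* The facts are stated as printed (Thm. 2.5.2; `μ_E(E) ≠ 0`; `DTIME[2^{cn}]` E-null — vM states
  the last for `c > 0`, the class for `c = 0` being contained in the one for `c = 1`). Their
  discharges (a clocked universal simulation for the union lemma and for `DTIME`; the diagonal
  language of a time-`N^k` martingale in `DTIME[2^{(k+2)n}]` for conservation) are NOT claimed.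
* NOT here: `p₂`/EXP-measure versions ("a similar theorem using EXP-uniform systems holds for
  EXP-measure"), supermartingales (vM Lemma 2.5.1), slow-but-sure winnings (Lemma 2.5.2).

## References

* D. van Melkebeek, *Randomness and Completeness in Computational Complexity*, LNCS 1950 (2000),
  §2.5.3 "Properties" (p. 50): measure conservation `μ_E(E) ≠ 0`, `DTIME[2^{cn}]` E-null,
  E-uniform systems, Thm. 2.5.2 (VanMelkebeek2000).
* J. H. Lutz, *Almost everywhere high nonuniform complexity*, JCSS 44 (1992) 220–258 (Lutz1992).
-/

namespace Literature.Computability.Complexity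

open _root_.Computability

/-! ### E-uniform systems -/

/-- An **E-uniform system of martingales** `(d_i)_i`: the map `(i, w) ↦ d_i(w)` is computable in
time polynomial in `i` and `N = |w|` jointly — the index presented in unary, `⟨1^i, w⟩`, the value
as the reduced fraction `(num, den)` exactly as in `IsPComputable`. van Melkebeek: "we can compute
`d_i(w)` in time `iᶜ · 2^{cn}` for some constant `c`" (`2^{cn} = N^c`).
[cite: VanMelkebeek2000, §2.5.3 p. 50 (E-uniform systems)] -/
def IsEUniform (ds : ℕ → List Bool → ℚ) : Prop :=
  PolyTimeComputable (fun p : ℕ × List Bool => boolPair (unaryEncodeNat p.1) p.2)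
    (fun q : ℚ => (encodingIntBool.pairBool encodingNatBool).encode (q.num, q.den))
    (fun p : ℕ × List Bool => ds p.1 p.2)

/-- A `p`-computable martingale, as a map computed on codes (`CodeFP`, identity input code).
[folklore] -/
theorem IsPComputable.codeFP {d : List Bool → ℚ} (h : IsPComputable d) :
    CodeFP (fun w : List Bool => w)
      (fun q : ℚ => (encodingIntBool.pairBool encodingNatBool).encode (q.num, q.den)) d := by
  obtain ⟨p, M, hM⟩ := h
  exact ⟨fun w => (encodingIntBool.pairBool encodingNatBool).encode ((d w).num, (d w).den),
    ⟨p, M, fun a => hM a⟩, fun _ => rfl⟩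

/-- Two `p`-computable martingales form an E-uniform system `d₁, d₂, d₂, d₂, …` (branch on the unary
index being `0`); in particular `IsEUniform` is inhabited by non-constant systems.
[cite: VanMelkebeek2000, §2.5.3 p. 50 (E-uniform systems)] -/
theorem isEUniform_cases {d₁ d₂ : List Bool → ℚ} (h₁ : IsPComputable d₁) (h₂ : IsPComputable d₂) :
    IsEUniform fun i => if i = 0 then d₁ else d₂ := by
  have hp : CodeFP (CodeFP.pairE CodeFP.unE fun w : List Bool => w) CodeFP.bitE
      (fun p : ℕ × List Bool => decide (p.1 = 0)) :=
    (CodeFP.eq CodeFP.unE_injective).comp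
      ((CodeFP.fst CodeFP.unE fun w : List Bool => w).pair (CodeFP.const _ (0 : ℕ)))
  have hg := h₁.codeFP.comp (CodeFP.snd CodeFP.unE fun w : List Bool => w)
  have hh := h₂.codeFP.comp (CodeFP.snd CodeFP.unE fun w : List Bool => w)
  exact ((hp.ite hg hh).congr fun p => by by_cases h0 : p.1 = 0 <;> simp [h0]).polyTimeComputable

/-- A single `p`-computable martingale, repeated, is an E-uniform system. [folklore] -/
theorem IsPComputable.isEUniform_const {d : List Bool → ℚ} (h : IsPComputable d) :
    IsEUniform fun _ => d := by
  simpa using isEUniform_cases h h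

/-! ### The three named facts of §2.5.3 (D-0014) -/

/-- **Lutz's E-uniform union lemma** (named fact): if `(d_i)_i` is an E-uniform system of
martingales and `d_i` covers the class `C_i` for every `i`, then `⋃_i C_i` has `p`-measure
(vM: E-measure) zero — the resource-bounded substitute for countable subadditivity, from which vM
derives that `DTIME[2^{cn}]` and `P` are E-null. [cite: VanMelkebeek2000, Thm. 2.5.2 p. 50] -/
def pMeasureZero_iUnion : Prop :=
  ∀ (ds : ℕ → List Bool → ℚ) (C : ℕ → Set (Language Bool)),
    (∀ i, IsMartingale (ds i)) → IsEUniform ds → (∀ i, C i ⊆ successSet (ds i)) →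
      PMeasureZero (⋃ i, C i)

/-- **Measure conservation** (named fact): `E = ⋃_c DTIME[2^{cn}]` does not have `p`-measure
zero, `μ_E(E) ≠ 0`. (Mechanism, not claimed: against a martingale computable in time `|w|^k` the
diagonal language `diagLanguage d` is decidable in time `2^{(k+2)n}`; see
`not_pMeasureZero_E_of_diagLanguage_mem`.) [cite: VanMelkebeek2000, §2.5.3 p. 50 (measure conservation)] -/
def not_pMeasureZero_E : Prop :=
  ¬ PMeasureZero E

/-- **`DTIME[2^{cn}]` has `p`-measure zero for every fixed `c`** (named fact; vM states it for
`c > 0`, and the class for `c = 0` is contained in the one for `c = 1`). With `pMeasureZero_P`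
below: `μ_p(P) = 0`. [cite: VanMelkebeek2000, §2.5.3 p. 50] -/
def pMeasureZero_DTIME : Prop :=
  ∀ c : ℕ, PMeasureZero (DTIME fun n => 2 ^ (c * n))

/-! ### Consequences -/

/-- The union lemma specialised to a single covering martingale repeated: a countable family of
classes covered by ONE `p`-computable martingale has `p`-null union (of course also immediate from
monotonicity; recorded as the degenerate instance of Thm. 2.5.2). [cite: VanMelkebeek2000, Thm. 2.5.2 p. 50] -/
theorem pMeasureZero_iUnion_of_forall_subset (hU : pMeasureZero_iUnion) {d : List Bool → ℚ}
    (hd : IsMartingale d) (hc : IsPComputable d) {C : ℕ → Set (Language Bool)}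
    (h : ∀ i, C i ⊆ successSet d) : PMeasureZero (⋃ i, C i) :=
  hU (fun _ => d) C (fun _ => hd) hc.isEUniform_const h

/-- The discharge path of measure conservation: it suffices that the diagonal language of every
`p`-computable martingale lies in `E` (`not_pMeasureZero_of_forall_diagLanguage_mem`).
[cite: VanMelkebeek2000, §2.5.3 p. 50 (measure conservation)] -/
theorem not_pMeasureZero_E_of_diagLanguage_mem
    (h : ∀ d, IsMartingale d → IsPComputable d → diagLanguage d ∈ E) : not_pMeasureZero_E :=
  not_pMeasureZero_of_forall_diagLanguage_mem h

/-- Measure conservation transported upward: no class containing `E` is `p`-null (e.g. `EXP`, all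
languages). [cite: VanMelkebeek2000, §2.5.3 p. 50 (measure conservation)] -/
theorem not_pMeasureZero_of_E_subset (h : not_pMeasureZero_E) {X : Set (Language Bool)}
    (hX : E ⊆ X) : ¬ PMeasureZero X := fun hp => h (hp.mono hX)

/-- A `p`-null class does not exhaust `E`: some language of `E` lies outside it (measure
conservation as an existence principle). [cite: VanMelkebeek2000, §2.5.3 p. 50 (measure conservation)] -/
theorem PMeasureZero.exists_mem_E_not_mem (h : not_pMeasureZero_E) {X : Set (Language Bool)}
    (hX : PMeasureZero X) : ∃ L ∈ E, L ∉ X := by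
  by_contra hc
  push Not at hc
  exact h (hX.mono fun L hL => hc L hL)

/-- `nᵈ ≤ dᵈ · 2ⁿ` (from `n ≤ d (⌊n/d⌋ + 1)` and `m + 1 ≤ 2ᵐ`). [folklore] -/
theorem pow_le_pow_mul_two_pow (n d : ℕ) : n ^ d ≤ d ^ d * 2 ^ n := by
  rcases Nat.eq_zero_or_pos d with rfl | hd
  · simp [Nat.one_le_two_pow]
  have h1 : d * (n / d) + n % d = n := Nat.div_add_mod n d
  have h2 : n % d < d := Nat.mod_lt n hd
  have hn : n ≤ d * (n / d + 1) := by
    rw [Nat.mul_add, Nat.mul_one]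
    linarith
  have hmd : n / d * d ≤ n := Nat.div_mul_le_self n d
  calc n ^ d ≤ (d * (n / d + 1)) ^ d := Nat.pow_le_pow_left hn d
    _ = d ^ d * (n / d + 1) ^ d := Nat.mul_pow _ _ _
    _ ≤ d ^ d * (2 ^ (n / d)) ^ d :=
        Nat.mul_le_mul_left _ (Nat.pow_le_pow_left Nat.lt_two_pow_self d)
    _ = d ^ d * 2 ^ (n / d * d) := by rw [← Nat.pow_mul]
    _ ≤ d ^ d * 2 ^ n := Nat.mul_le_mul_left _ (Nat.pow_le_pow_right (by norm_num) hmd)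

/-- `P ⊆ DTIME[2ⁿ]` (`nᵏ = O(2ⁿ)`; written `2 ^ (1 * n)` to match `pMeasureZero_DTIME` and `E`).
[cite: VanMelkebeek2000, §2.5.3 p. 50] -/
theorem P_subset_DTIME_two_pow : Classes.P ⊆ DTIME fun n => 2 ^ (1 * n) := by
  intro L hL
  simp only [Classes.P, Set.mem_iUnion] at hL
  obtain ⟨k, c, hc⟩ := hL
  refine ⟨c * k ^ k + c, timeClass_mono (fun n => ?_) hc⟩
  dsimp only
  have hk := Nat.mul_le_mul_left c (pow_le_pow_mul_two_pow n k)
  rw [Nat.one_mul]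
  nlinarith [hk, Nat.one_le_two_pow (n := n), Nat.zero_le (c * k ^ k)]

/-- `P ⊆ E`. [cite: VanMelkebeek2000, §2.5.3 p. 50] -/
theorem P_subset_E : Classes.P ⊆ E := fun _ hL =>
  Set.mem_iUnion.2 ⟨1, P_subset_DTIME_two_pow hL⟩

/-- **`μ_p(P) = 0`** (from `pMeasureZero_DTIME`): `P ⊆ DTIME[2ⁿ]` is `p`-null.
[cite: VanMelkebeek2000, §2.5.3 p. 50 (P has E-measure zero)] -/
theorem pMeasureZero_P (h : pMeasureZero_DTIME) : PMeasureZero Classes.P :=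
  (h 1).mono P_subset_DTIME_two_pow

end Literature.Computability.Complexity
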